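import Literature.AlgebraicGeometry.HodgeTheory.WeilClassesFieldTypeFourDichotomy
import Literature.AlgebraicGeometry.HodgeTheory.DivisorLefschetzGroupIsogeny
import HarnessLib

/-!
# Moonen–Zarhin's Table 1, THE TYPE-4 ROW «`B = End⁰(X)`» (`d ≥ 2` or `m ≥ 2`), and Lemma (1) «`Z(G_div(X)) = U_E`»,
# FROM `End(X)`-LEVEL DATA: the centre of `End⁰(X)` is a CM field and `End(X)` is not commutative
# (Moonen–Zarhin 1998 §1, on the carrier `H¹(X(ℂ); ℂ)`)

Layer `Literature/AlgebraicGeometry/HodgeTheory`; THEOREMS ONLY — no definition, no named fact, no `sorry` (D-0026, net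
debt 0).  Sequel of the seat's `WeilClassesFieldTypeFourDichotomy` (generation 25: the bicommutant `E'' = End⁰(X) ⊗ ℂ` of a
complex abelian variety whose endomorphism algebra has CM centre `E = ℚ(ψ)` carries ADJOINT-CLOSED MATRIX UNITS `U_{ab}`,
`U_{ab}† = U_{ba}`, commuting with `ψ^*`, with `E'' ⊆ ℂ⟨ψ^*, U_{ab}⟩` — `bicommutant_typeFour_data` and
`Literature.RingTheory.SimpleModule.exists_matrixUnits_adj_eq_of_center_le_adjoin`), of `DivisorLefschetzGroup` (g13:
`symmetricPullbackSpan A h = S_λ ⊗ ℂ`, `divisorLefschetzGroup A h = G_div(X)(ℂ)`,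
`divisorLefschetzGroup_eq_unitaryCentralizerGroup_of_forall_mem_adjoin`) and of `DivisorLefschetzGroupIsogeny` Chapter II
(g15: Lemma (1) and Lemma (3) UNDER the hypothesis `B ⊗ ℂ = End⁰(X) ⊗ ℂ`).  The tree had «`B = Mat_m(D) = End⁰(X)`» only for
`X` isogenous to a power `A^{a+2}` (`DivisorAlgebraSelfProduct`, `DivisorAlgebraPowers`,
`DivisorLefschetzGroupIsogeny.adjoin_symmetricPullbackSpan_eq_span_of_isIsogenous_powSucc`): the row «type 4, `m = 1`,
`d ≥ 2`» (a SIMPLE abelian variety of type IV whose endomorphism algebra is a non-commutative division algebra) was not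
covered.  Here it is, uniformly for every `d`, `m` with `dm ≥ 2`, from `End(X)`-level data and with NO presentation of
`End⁰(X)`.

## The print

B. J. J. Moonen, Yu. G. Zarhin, *Weil classes on abelian varieties*, J. reine angew. Math. **496** (1998) 83–92 =
arXiv:alg-geom/9612017 [MoonenZarhin1998WeilClasses], §1 (held text `paper:arxiv-alg-geom_9612017`).  Chunk p0002
L46–L51: «Let `D = End⁰(Y)`, let `E` be the center of `D`, and let `E₀` be the maximal totally real subfield of `E`. We
write `e₀ = [E₀:ℚ]`, `e = [E:ℚ]`, `d² = dim_E(D)` …»; L54–L64: «Choose a polarization `λ` of `X`, and write `α ↦ α†` for the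
associated Rosati involution of `End⁰(X) ≅ M_m(D)`. Let `S_λ ⊆ End⁰(X)` be the set of `†`-symmetric elements. We define the
algebra `B ⊆ End⁰(X)` as the `ℚ`-subalgebra generated by `S_λ`. … For all possible types in the Albert classification one can
determine the algebra `B` and its center `K_B`. The results are listed in Table 1.»; L67–L71: «We define the algebraic group
`G_div(X) ⊆ SP(V, φ)` as the centralizer of `B` in `SP(V, φ)`. More precisely, `G_div(X) := Gl_B(V) ∩ SP(V, φ)`.»; L96–L97:
«(In fact, if `m ≥ 2` or if `X` is of type 1 or 2, then we simply have `Δ = D`. If `m = 1` then `Δ = B`.)»; L121–L127,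
Lemma: «(1) The center of `G_div(X)` is the group `U_{K_B}` given by `U_{K_B}(R) = {a ∈ (K_B ⊗_ℚ R)^* ∣ a a† = 1}`. For `X` of
type 4 with either `d ≥ 2` or `m ≥ 2` this is a connected torus of rank `e₀`; in all other cases it is finite.»; chunk p0003
L5: «(3) `End(V_X)^{G_div(X)} = B`»; L8–L10: «Proof. To prove this, we can first extend scalars to `ℂ`, and (1) and (2) then
readily follow from Table 2.»; and, in the proof of Criterion (2), L92–L98, VERBATIM: «Next assume that `X` is of type 4 with
either `m ≥ 2` or `d ≥ 2`. We have `F ⊆ B = End⁰(X)`. Since in this case `G_div(X)` is connected (see (Gdivprops)), it acts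
trivially on `W_F` if and only if the composition `U_E = Z(G_div) ⊂ G_div(X) ↪ Gl_F(V_Y) —det_F→ F^*` is trivial.»  So TABLE 1
reads, in the type-4 rows: `B = E₀`, `K_B = E₀` for `d = 1`, `m = 1` (the tree's `WeilClassesFieldCommutativeDivisorAlgebra`:
for `End(X)` commutative `B ⊗ ℂ = S_λ ⊗ ℂ`), and **`B = End⁰(X)`, `K_B = E`, `Z(G_div(X)) = U_E` for `d ≥ 2` or `m ≥ 2`**.
J. S. Milne, *Lefschetz classes on abelian varieties*, Duke Math. J. **96** (1999) [Milne1999LefschetzClasses], §1 p. 643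
Remark 1.2 («the centralizer of `C(A)` in `End_k(V(A))` is `End⁰(A) ⊗_ℚ k`»), p. 644 (`S(A)`), §2 p. 651 (type IV:
«`Ē = M_d(k^al) × M_d(k^al)`, `(α, β)† = (βᵗʳ, αᵗʳ)`»).

## What is proved

«type 4 with `d ≥ 2` or `m ≥ 2`» is read at `End(X)`-level, as in all the seat's type-4 files, as: `ψ ∈ End(X)` CENTRAL with
`R(ψ) = 0` (`R` monic irreducible over `ℚ`), Rosati image `ψ'` (`Q_h(ψ^* x, y) = Q_h(x, ψ'^* y)`) with `N'ψ' ∈ ℤ[ψ]`, `N' ≠ 0`,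
and `ψ' ≠ ψ` (`E = ℚ(ψ)` is a CM field on which `†` is complex conjugation), every `g ∈ End(X)` commuting with `End(X)` has
`N g ∈ ℤ[ψ]` for some `N ≠ 0` («`Z(End⁰(X)) = E`»), AND one pair `α, β ∈ End(X)` with `α ≫ β ≠ β ≫ α` («`d ≥ 2` or `m ≥ 2`»:
`End⁰(X) ≅ M_m(D)` with `dim_E D = d²` is commutative iff `d = m = 1`).

* §1 ON THE CARRIER (`Literature.AlgebraicGeometry.HodgeTheory`, the abstract form): for `h ∈ H²` with `Q_h` non-degenerate
  and a SEMISIMPLE subalgebra `𝔅` of the pull-back algebra, stable under `Q_h`-adjoints, containing `ψ^*` in its centre,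
  with centre inside `ℂ[ψ^*]`, no real place (`ker(ψ^* − σ) ∩ ker(ψ'^* − σ) = 0`) and a `ℂ`-basis `(ψ^{*j} b_k)`: IF `𝔅` IS
  NOT COMMUTATIVE then **`le_adjoin_symmetricPullbackSpan_of_semisimple_of_ne`**: `𝔅 ⊆ B ⊗ ℂ = ℂ⟨S_λ ⊗ ℂ⟩`.  Mechanism
  (Table 1, type 4): with the adjoint-closed units `U_{ab}` (`a, b < d`) of `InvolutionSecondKindMatrixUnits`, the elements
  `U_{aa}`, `U_{ab} + U_{ba}` and `ψ^* U_{ab} + U_{ba} ψ'^*` are Rosati-symmetric; for `a ≠ b`,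
  `U_{aa} (U_{ab} + U_{ba}) = U_{ab}` and `U_{aa} (ψ^* U_{ab} + U_{ba} ψ'^*) U_{bb} = ψ^* U_{ab}`, so `ψ^* U_{aa} =
  ψ^* U_{ab} U_{ba} ∈ B ⊗ ℂ` and `ψ^* = Σ_a ψ^* U_{aa} ∈ B ⊗ ℂ`; this needs `d ≥ 2`, and `d = 1` would give
  `𝔅 ⊆ ℂ[ψ^*]`, commutative.
* §2 FROM `End(X)`-LEVEL DATA, for EVERY complex abelian variety `X` (`𝔅 = E''`, non-commutative by the faithfulness of
  `H¹`, `AbelianVariety.hom_eq_of_complexBetti_map_one_eq`):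
  **`pullbackOne_mem_adjoin_symmetricPullbackSpan_of_CMCentre_End_of_ne`** («`F ⊆ B = End⁰(X)`»: every `χ^*` lies in
  `B ⊗ ℂ`), **`adjoin_symmetricPullbackSpan_eq_span_of_CMCentre_End_of_ne`** (TABLE 1: `B ⊗ ℂ = End⁰(X) ⊗ ℂ`, the `ℂ`-span of
  the pull-backs), **`divisorLefschetzGroup_eq_unitaryCentralizerGroup_of_CMCentre_End_of_ne`** (`G_div(X)(ℂ)` is Milne's
  `S(X)(ℂ)`, the centralizer of ALL of `End⁰(X)`), `forall_mem_divisorLefschetzGroup_comm_iff_mem_span_of_CMCentre_End_of_ne`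
  (LEMMA (3): `End(V_X ⊗ ℂ)^{G_div(X)(ℂ)} = End⁰(X) ⊗ ℂ`),
  **`mem_center_divisorLefschetzGroup_iff_coe_mem_adjoin_singleton_of_CMCentre_End_of_ne`** (LEMMA (1), `K_B = E`: an
  element of `G_div(X)(ℂ)` is central iff it lies in `ℂ[ψ^*] = E ⊗ ℂ`) and
  `mem_divisorLefschetzGroup_and_forall_comm_iff_of_CMCentre_End_of_ne` (the print's set «`U_E(ℂ) = {a ∈ (E ⊗ ℂ)^* ∣ a a† = 1}`»:
  central elements of `G_div(X)(ℂ)` = automorphisms in `ℂ[ψ^*]` preserving `Q_h`).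

## Scope (honest column)

`⊗ ℂ` throughout (the carrier is `H¹(X(ℂ); ℂ)`; `B`, `K_B`, `G_div` as `ℚ`-objects are not formed); «connected torus of rank
`e₀`» is not formalised (no algebraic groups); positivity of `†` is not used; `d`, `m` do not appear — the hypothesis is
«`End(X)` not commutative», which for `Z(End⁰ X) = E` a field is «`d ≥ 2` or `m ≥ 2`».

## References

* [MoonenZarhin1998WeilClasses] B. J. J. Moonen, Yu. G. Zarhin, Weil classes on abelian varieties, J. reine angew. Math.
  496 (1998) 83–92; arXiv:alg-geom/9612017: §1 (chunk p0002 L46–L71, L96–L97, L121–L127; chunk p0003 L5–L10, L92–L98),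
  Table 1, Lemma (1), (3).
* [Milne1999LefschetzClasses] J. S. Milne, Lefschetz classes on abelian varieties, Duke Math. J. 96 (1999) 639–675, §1
  pp. 642–644 (Remark 1.2), §2 p. 651.
* [MumfordAV1970] D. Mumford, Abelian Varieties (1970), §19 Cor. 2 of Thm. 1 (`End⁰` semisimple), §21 (Albert types).
* [Deligne1982HodgeCycles] P. Deligne, Hodge cycles on abelian varieties, LNM 900 (1982), I §3 Prop. 3.4.

## Provenance

Lane `lit-hodgefound` (Track 2, Layer A), prover seat `lit-hodgefound-p21` (generation 26), row g26-#4.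
-/

noncomputable section

open CategoryTheory Polynomial Module
open Literature.AlgebraicTopology.SingularHomology
open Literature.AlgebraicGeometry.Motives
open Literature.AlgebraicGeometry.VanGeemen1994 (hodgeClassSpan pullbackOne)
open Literature.AlgebraicGeometry.Milne1999
open Literature.RingTheory.SimpleModule (adj adj_spec' eq_adj_of_forall adj_mul adj_add adj_adj_of_isAlt
  exists_matrixUnits_adj_eq_of_center_le_adjoin)

namespace Literature.AlgebraicGeometry.HodgeTheory

/-! ### §0 (private) the complex roots of `R`; the pull-back algebra is the span of the pull-backs -/

section Prelim

variable {A : AbelianVariety ℂ}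

/-- The complex roots of a monic integer polynomial irreducible over `ℚ`: simple, `deg R` of them, their nodal
polynomial is `R` itself. [folklore] -/
private theorem nodal_rootsFinset_eq' {R : Polynomial ℤ} (hRm : R.Monic)
    (hRirr : Irreducible (R.map (Int.castRingHom ℚ))) :
    Lagrange.nodal (R.map (Int.castRingHom ℂ)).roots.toFinset id = R.map (Int.castRingHom ℂ) ∧
      (R.map (Int.castRingHom ℂ)).roots.toFinset.card = R.natDegree := by
  classical
  have hsep : (R.map (Int.castRingHom ℂ)).Separable := by
    rw [map_castRingHom_complex_eq]
    exact hRirr.separable.map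
  have hmon : (R.map (Int.castRingHom ℂ)).Monic := hRm.map _
  have hnodup : (R.map (Int.castRingHom ℂ)).roots.Nodup := Polynomial.nodup_roots hsep
  refine ⟨?_, ?_⟩
  · have hsplit := (IsAlgClosed.splits (R.map (Int.castRingHom ℂ))).eq_prod_roots_of_monic hmon
    rw [Lagrange.nodal_eq, ← Multiset.toFinset_eq hnodup, Finset.prod_mk]
    exact hsplit.symm
  · rw [Multiset.toFinset_card_of_nodup hnodup, ← Polynomial.Splits.natDegree_eq_card_roots (IsAlgClosed.splits _),
      Polynomial.natDegree_map_eq_of_injective (Int.castRingHom ℂ).injective_int]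

/-- The `ℂ`-algebra generated by the pull-backs is, elementwise, their `ℂ`-span (`E''`).
[cite: Milne1999LefschetzClasses, §1 Remark 1.2 (p. 643)] -/
private theorem mem_span_of_mem_adjoin_range_pullbackOne {X : Module.End ℂ (complexBetti A.X 1)}
    (hX : X ∈ Algebra.adjoin ℂ (Set.range fun χ : A ⟶ A ↦ pullbackOne A χ)) :
    X ∈ Submodule.span ℂ (Set.range fun χ : A ⟶ A ↦ pullbackOne A χ) := by
  have hle : Algebra.adjoin ℂ (Set.range fun χ : A ⟶ A ↦ pullbackOne A χ) ≤ bicommutant A :=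
    Algebra.adjoin_le (by rintro _ ⟨χ, rfl⟩; exact pullbackOne_mem_bicommutant χ)
  exact mem_bicommutant_iff_mem_span.1 (hle hX)

/-- `B ⊗ ℂ ⊆ E''`: the algebra generated by `S_λ ⊗ ℂ` lies in the bicommutant.
[cite: MoonenZarhin1998WeilClasses, §1 (chunk p0002 L54–L58)] [cite: Milne1999LefschetzClasses, §1 Remark 1.2 (p. 643)] -/
private theorem adjoin_symmetricPullbackSpan_le_bicommutant {h : complexBetti A.X 2} :
    Algebra.adjoin ℂ (symmetricPullbackSpan A h : Set (Module.End ℂ (complexBetti A.X 1))) ≤ bicommutant A :=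
  Algebra.adjoin_le fun _ hT ↦ mem_bicommutant_iff_mem_span.2 (symmetricPullbackSpan_le_span hT)

/-- Pull-back is faithful: a non-commuting pair in `End(X)` gives a non-commuting pair of pull-backs.
[cite: Milne1999LefschetzClasses, §1 Remark 1.2 (p. 643)] -/
private theorem pullbackOne_mul_ne_of_comp_ne {α β : A ⟶ A} (hαβ : α ≫ β ≠ β ≫ α) :
    pullbackOne A α * pullbackOne A β ≠ pullbackOne A β * pullbackOne A α := by
  intro e
  rw [← pullbackOne_comp_eq_mul, ← pullbackOne_comp_eq_mul] at e
  exact hαβ (AbelianVariety.hom_eq_of_complexBetti_map_one_eq (ModuleCat.hom_ext e))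

end Prelim

/-! ### §1 ON THE CARRIER: a non-commutative semisimple `Q_h`-adjoint-stable algebra with CM centre `ℂ[ψ^*]` lies in `B ⊗ ℂ` -/

section Carrier

variable {A : AbelianVariety ℂ} {h : complexBetti A.X 2} {ψ ψ' : A ⟶ A} {R : Polynomial ℤ} {r : ℕ}
  {𝔅 : Subalgebra ℂ (Module.End ℂ (complexBetti A.X 1))} {b : Fin r → Module.End ℂ (complexBetti A.X 1)}

/-- **TABLE 1, TYPE 4 WITH `d ≥ 2` OR `m ≥ 2`, ON THE CARRIER: «`B = End⁰(X)`».**  `A` a complex abelian variety, `h ∈ H²`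
with `Q_h` non-degenerate on `H¹(A(ℂ); ℂ)`; `𝔅` a SEMISIMPLE subalgebra of the `ℂ`-algebra generated by the pull-backs,
stable under `Q_h`-adjoints; `ψ ∈ End(A)` with `ψ^* ∈ 𝔅` central in `𝔅`, `R(ψ) = 0` (`R` monic irreducible over `ℚ`), Rosati
image `ψ'` (`Q_h(ψ^* x, y) = Q_h(x, ψ'^* y)`) with no real place `ker(ψ^* − σ) ∩ ker(ψ'^* − σ) = 0`; the CENTRE of `𝔅` lies
in `ℂ[ψ^*]` and `𝔅` has a `ℂ`-basis `(ψ^{*j} b_k)_{j < deg R, k < r}`.  IF `𝔅` contains two elements `X₁ X₂ ≠ X₂ X₁`, THEN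
`𝔅 ⊆ B ⊗ ℂ`, the subalgebra generated by the `Q_h`-symmetric elements `S_λ ⊗ ℂ` of the pull-back span.  Proof: the
adjoint-closed matrix units `U_{ab} ∈ 𝔅` (`a, b < d`, `U_{ab}† = U_{ba}`, `[U_{ab}, ψ^*] = 0`, `𝔅 ⊆ ℂ⟨ψ^*, U⟩`) of
`InvolutionSecondKindMatrixUnits`; `U_{aa}`, `U_{ab} + U_{ba}`, `ψ^* U_{ab} + U_{ba} ψ'^*` are symmetric, and for `a ≠ b`
`U_{aa}(U_{ab} + U_{ba}) = U_{ab}`, `U_{aa}(ψ^* U_{ab} + U_{ba} ψ'^*)U_{bb} = ψ^* U_{ab}`, whence `ψ^* = Σ_a ψ^* U_{ab}U_{ba} ∈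
B ⊗ ℂ` (`d ≥ 2` because `d = 1` forces `𝔅 ⊆ ℂ[ψ^*]`, commutative).
[cite: MoonenZarhin1998WeilClasses, §1 Table 1 and proof of Criterion (2) («Next assume that X is of type 4 with either m ≥ 2 or d ≥ 2. We have F ⊆ B = End⁰(X)», chunk p0003 L92–L93)]
[cite: Milne1999LefschetzClasses, §2 p. 651 («Ē = M_d(k^al) × M_d(k^al), (α, β)† = (βᵗʳ, αᵗʳ)»)] -/
theorem le_adjoin_symmetricPullbackSpan_of_semisimple_of_ne
    (hnd : ∀ x : complexBetti A.X 1, (∀ y, polarizationPairingOne A.X h (A.dim - 1) x y = 0) → x = 0)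
    [IsSemisimpleRing 𝔅] (h𝔅 : 𝔅 ≤ Algebra.adjoin ℂ (Set.range fun χ : A ⟶ A ↦ pullbackOne A χ))
    (h𝔅adj : ∀ X ∈ 𝔅, ∃ X' ∈ 𝔅, ∀ x y : complexBetti A.X 1,
      polarizationPairingOne A.X h (A.dim - 1) (X x) y = polarizationPairingOne A.X h (A.dim - 1) x (X' y))
    (hψ𝔅 : pullbackOne A ψ ∈ 𝔅) (hψc : ∀ X ∈ 𝔅, X * pullbackOne A ψ = pullbackOne A ψ * X)
    (hRm : R.Monic) (hRirr : Irreducible (R.map (Int.castRingHom ℚ)))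
    (hψR : Polynomial.eval₂ (Int.castRingHom (CategoryTheory.End A)) (ψ : CategoryTheory.End A) R = 0)
    (hadj : ∀ x y : complexBetti A.X 1, polarizationPairingOne A.X h (A.dim - 1) (pullbackOne A ψ x) y =
      polarizationPairingOne A.X h (A.dim - 1) x (pullbackOne A ψ' y))
    (hCM : ∀ σ : ℂ, (pullbackOne A ψ).eigenspace σ ⊓ (pullbackOne A ψ').eigenspace σ = ⊥)
    (hZ : ∀ z ∈ 𝔅, (∀ X ∈ 𝔅, X * z = z * X) →
      z ∈ Algebra.adjoin ℂ ({pullbackOne A ψ} : Set (Module.End ℂ (complexBetti A.X 1))))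
    (hb : LinearIndependent ℂ (fun jk : Fin R.natDegree × Fin r ↦ pullbackOne A ψ ^ (jk.1 : ℕ) * b jk.2))
    (hspan : Subalgebra.toSubmodule 𝔅 =
      Submodule.span ℂ (Set.range fun jk : Fin R.natDegree × Fin r ↦ pullbackOne A ψ ^ (jk.1 : ℕ) * b jk.2))
    {X₁ X₂ : Module.End ℂ (complexBetti A.X 1)} (hX₁ : X₁ ∈ 𝔅) (hX₂ : X₂ ∈ 𝔅) (hne : X₁ * X₂ ≠ X₂ * X₁) :
    𝔅 ≤ Algebra.adjoin ℂ (symmetricPullbackSpan A h : Set (Module.End ℂ (complexBetti A.X 1))) := by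
  classical
  haveI : Module.Finite ℂ (complexBetti A.X 1) := abelianVarietyCohomologyExteriorH1_holds.finite_one A
  haveI : Nontrivial (complexBetti A.X 1) := by
    rcases subsingleton_or_nontrivial (complexBetti A.X 1) with hs | hs
    · exact absurd (Subsingleton.elim (X₁ * X₂) (X₂ * X₁)) hne
    · exact hs
  set Q := polarizationPairingOne A.X h (A.dim - 1) with hQdef
  set T : Module.End ℂ (complexBetti A.X 1) := pullbackOne A ψ with hTdef
  set T' : Module.End ℂ (complexBetti A.X 1) := pullbackOne A ψ' with hT'def
  set 𝒜 := Algebra.adjoin ℂ (symmetricPullbackSpan A h : Set (Module.End ℂ (complexBetti A.X 1))) with h𝒜def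
  -- the scalar form `B = λ ∘ Q_h`; `Q_h`-adjoints are `B`-adjoints
  obtain ⟨B, hBalt, hBnd, lam, hlam, hBQ⟩ := exists_bilinForm_isAlt_nondegenerate (A := A) hnd
  have hadjB : ∀ {X X' : Module.End ℂ (complexBetti A.X 1)}, (∀ x y, Q (X x) y = Q x (X' y)) →
      adj B hBnd X = X' := by
    intro X X' hXX'
    symm
    refine eq_adj_of_forall B hBnd fun v w ↦ ?_
    rw [← hBalt.neg_eq, ← hBalt.neg_eq (X w), hBQ, hBQ, hXX']
  have hE : ∀ X ∈ 𝔅, adj B hBnd X ∈ 𝔅 := by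
    intro X hX
    obtain ⟨X', hX'𝔅, hXX'⟩ := h𝔅adj X hX
    rw [hadjB hXX']
    exact hX'𝔅
  have hTadj : adj B hBnd T = T' := hadjB hadj
  have hT'adj : adj B hBnd T' = T := by rw [← hTadj, adj_adj_of_isAlt B hBnd hBalt]
  have hT'𝔅 : T' ∈ 𝔅 := hTadj ▸ hE T hψ𝔅
  have hCM' : ∀ σ : ℂ, T.eigenspace σ ⊓ (adj B hBnd T).eigenspace σ = ⊥ := fun σ ↦ by rw [hTadj]; exact hCM σ
  -- the roots of `R`
  set s : Finset ℂ := (R.map (Int.castRingHom ℂ)).roots.toFinset with hsdef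
  obtain ⟨hnodal, hscard⟩ := nodal_rootsFinset_eq' hRm hRirr
  have hTs : aeval T (Lagrange.nodal s id) = 0 := by
    rw [hnodal]; exact aeval_hom_complexBetti_map_one_eq_zero hψR
  -- reindex the basis along `Fin (deg R) ≃ Fin #s`
  let ε : Fin s.card × Fin r ≃ Fin R.natDegree × Fin r := (finCongr hscard).prodCongr (Equiv.refl _)
  have hcomp : (fun jk : Fin s.card × Fin r ↦ T ^ (jk.1 : ℕ) * b jk.2) =
      (fun jk : Fin R.natDegree × Fin r ↦ T ^ (jk.1 : ℕ) * b jk.2) ∘ ε := by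
    funext jk; rfl
  have hb' : LinearIndependent ℂ (fun jk : Fin s.card × Fin r ↦ T ^ (jk.1 : ℕ) * b jk.2) := by
    rw [hcomp, linearIndependent_equiv]; exact hb
  have hspan' : Subalgebra.toSubmodule 𝔅 =
      Submodule.span ℂ (Set.range fun jk : Fin s.card × Fin r ↦ T ^ (jk.1 : ℕ) * b jk.2) := by
    rw [hcomp, ε.surjective.range_comp]; exact hspan
  -- the adjoint-closed matrix units
  obtain ⟨d, U, hd, -, hUmem, hUmul, hUsum, hUadj, hUT, h𝔅U⟩ :=
    exists_matrixUnits_adj_eq_of_center_le_adjoin B hBnd hBalt 𝔅 hE hψ𝔅 hψc s hTs hZ hCM' hb' hspan'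
  -- `B`-self-adjoint elements of `𝔅` are Rosati-symmetric elements of the pull-back span
  have hsym : ∀ X ∈ 𝔅, adj B hBnd X = X → X ∈ symmetricPullbackSpan A h := by
    intro X hX hXa
    refine ⟨mem_span_of_mem_adjoin_range_pullbackOne (h𝔅 hX), fun x y ↦ hlam ?_⟩
    rw [← hBQ, ← hBQ, adj_spec' B hBnd hBalt, hXa]
  -- `d ≥ 2`: for `d = 1` the algebra `𝔅 ⊆ ℂ[ψ^*]` would be commutative
  have h2 : 2 ≤ d := by
    by_contra hlt
    have hd1 : d = 1 := by omega
    subst hd1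
    have hU1 : U 0 0 = 1 := by rw [← hUsum, Fin.sum_univ_one]
    have hle : 𝔅 ≤ Algebra.adjoin ℂ ({T} : Set (Module.End ℂ (complexBetti A.X 1))) := by
      refine h𝔅U.trans (Algebra.adjoin_le ?_)
      intro X hX
      rcases Set.mem_insert_iff.1 hX with rfl | ⟨⟨a, c⟩, rfl⟩
      · exact Algebra.self_mem_adjoin_singleton ℂ _
      · change U a c ∈ _
        rw [Fin.eq_zero a, Fin.eq_zero c, hU1]
        exact Subalgebra.one_mem _
    have hc : Commute X₁ X₂ :=
      Algebra.commute_of_mem_adjoin_singleton_of_commute (hle hX₂)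
        (Algebra.commute_of_mem_adjoin_self (hle hX₁)).symm
    exact hne hc.eq
  -- for every index there is a different one
  have hex : ∀ a : Fin d, ∃ c : Fin d, c ≠ a := fun a ↦ by
    by_cases ha : (a : ℕ) = 0
    · exact ⟨⟨1, h2⟩, fun e ↦ by rw [Fin.ext_iff, Fin.val_mk] at e; omega⟩
    · exact ⟨⟨0, hd⟩, fun e ↦ by rw [Fin.ext_iff, Fin.val_mk] at e; omega⟩
  -- the units lie in `B ⊗ ℂ`
  have hUaa : ∀ a, U a a ∈ 𝒜 := fun a ↦ Algebra.subset_adjoin (hsym _ (hUmem a a) (hUadj a a))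
  have hUsym : ∀ a c, U a c + U c a ∈ symmetricPullbackSpan A h := fun a c ↦
    hsym _ (add_mem (hUmem a c) (hUmem c a)) (by rw [adj_add, hUadj, hUadj, add_comm])
  have hU𝒜 : ∀ a c, U a c ∈ 𝒜 := by
    intro a c
    by_cases hac : a = c
    · subst hac; exact hUaa a
    · have e : U a c = U a a * (U a c + U c a) := by
        rw [mul_add, hUmul a a a c, hUmul a a c a, if_pos rfl, if_neg hac, add_zero]
      rw [e]
      exact mul_mem (hUaa a) (Algebra.subset_adjoin (hUsym a c))
  -- `ψ^* U_{ac} ∈ B ⊗ ℂ` for `a ≠ c`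
  have hTU : ∀ a c, a ≠ c → T * U a c ∈ 𝒜 := by
    intro a c hac
    have hY : T * U a c + U c a * T' ∈ symmetricPullbackSpan A h := by
      refine hsym _ (add_mem (mul_mem hψ𝔅 (hUmem a c)) (mul_mem (hUmem c a) hT'𝔅)) ?_
      rw [adj_add, adj_mul, adj_mul, hUadj, hUadj, hTadj, hT'adj, add_comm]
    have hmem : U a a * (T * U a c + U c a * T') * U c c = T * U a c := by
      rw [mul_add, add_mul, ← mul_assoc (U a a) T (U a c), hUT a a, mul_assoc T (U a a) (U a c), hUmul a a a c,
        if_pos rfl, mul_assoc T (U a c) (U c c), hUmul a c c c, if_pos rfl, ← mul_assoc (U a a) (U c a) T',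
        hUmul a a c a, if_neg hac, zero_mul, zero_mul, add_zero]
    rw [← hmem]
    exact mul_mem (mul_mem (hUaa a) (Algebra.subset_adjoin hY)) (hUaa c)
  -- `ψ^* = Σ_a ψ^* U_{ac} U_{ca} ∈ B ⊗ ℂ`
  have hT𝒜 : T ∈ 𝒜 := by
    have e : T = ∑ a, T * U a a := by rw [← Finset.mul_sum, hUsum, mul_one]
    rw [e]
    refine Subalgebra.sum_mem _ fun a _ ↦ ?_
    obtain ⟨c, hca⟩ := hex a
    have e2 : T * U a a = T * U a c * U c a := by rw [mul_assoc, hUmul a c c a, if_pos rfl]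
    rw [e2]
    exact mul_mem (hTU a c (Ne.symm hca)) (hU𝒜 c a)
  -- `𝔅 ⊆ ℂ⟨ψ^*, U⟩ ⊆ B ⊗ ℂ`
  refine h𝔅U.trans (Algebra.adjoin_le ?_)
  intro X hX
  rcases Set.mem_insert_iff.1 hX with rfl | ⟨⟨a, c⟩, rfl⟩
  · exact hT𝒜
  · exact hU𝒜 a c

end Carrier

/-! ### §2 FROM `End(X)`-LEVEL DATA: CM centre `E = ℚ(ψ)` and one non-commuting pair -/

section EndLevel

variable {A : AbelianVariety ℂ} {h : complexBetti A.X 2} {ψ ψ' α β : A ⟶ A} {R : Polynomial ℤ}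

/-- **«`F ⊆ B = End⁰(X)`» FOR TYPE 4 WITH `d ≥ 2` OR `m ≥ 2`, FROM `End(X)`.**  Let `A` be a complex abelian variety,
`h ∈ B¹(A) ⊗ ℂ` with `Q_h` non-degenerate, and suppose THE CENTRE OF `End⁰(A)` IS THE CM FIELD `E = ℚ(ψ)`: `ψ ∈ End(A)`
central with `R(ψ) = 0` (`R` monic irreducible over `ℚ`), Rosati image `ψ'` (`Q_h(ψ^* x, y) = Q_h(x, ψ'^* y)`) with
`N'ψ' ∈ ℤ[ψ]` (`N' ≠ 0`) and `ψ' ≠ ψ`, every `g ∈ End(A)` commuting with `End(A)` has `N g ∈ ℤ[ψ]` for some `N ≠ 0`; and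
suppose `End(A)` is NOT commutative: `α ≫ β ≠ β ≫ α` («`d ≥ 2` or `m ≥ 2`»).  Then EVERY pull-back `χ^*`, `χ ∈ End(A)`,
lies in `B ⊗ ℂ`, the subalgebra of `End_ℂ H¹(A(ℂ); ℂ)` generated by the Rosati-symmetric elements `S_λ ⊗ ℂ`.
[cite: MoonenZarhin1998WeilClasses, §1 Table 1 and proof of Criterion (2) (chunk p0003 L92–L93: «Next assume that X is of type 4 with either m ≥ 2 or d ≥ 2. We have F ⊆ B = End⁰(X)»)]
[cite: Milne1999LefschetzClasses, §1 Remark 1.2 (p. 643), §2 p. 651] -/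
theorem pullbackOne_mem_adjoin_symmetricPullbackSpan_of_CMCentre_End_of_ne (hh : h ∈ hodgeClassSpan A.dim A.X 1)
    (hnd : ∀ x : complexBetti A.X 1, (∀ y, polarizationPairingOne A.X h (A.dim - 1) x y = 0) → x = 0)
    (hψ : ∀ χ : A ⟶ A, ψ ≫ χ = χ ≫ ψ) (hRm : R.Monic) (hRirr : Irreducible (R.map (Int.castRingHom ℚ)))
    (hψR : Polynomial.eval₂ (Int.castRingHom (CategoryTheory.End A)) (ψ : CategoryTheory.End A) R = 0)
    (hadj : ∀ x y : complexBetti A.X 1, polarizationPairingOne A.X h (A.dim - 1) (pullbackOne A ψ x) y =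
      polarizationPairingOne A.X h (A.dim - 1) x (pullbackOne A ψ' y))
    (hψ'E : ∃ N : ℤ, N ≠ 0 ∧ End.of (N • ψ') ∈ Subring.closure {End.of ψ}) (hne : ψ' ≠ ψ)
    (hZ : ∀ g : A ⟶ A, (∀ χ : A ⟶ A, g ≫ χ = χ ≫ g) →
      ∃ N : ℤ, N ≠ 0 ∧ End.of (N • g) ∈ Subring.closure {End.of ψ})
    (hαβ : α ≫ β ≠ β ≫ α) (χ : A ⟶ A) :
    pullbackOne A χ ∈ Algebra.adjoin ℂ (symmetricPullbackSpan A h : Set (Module.End ℂ (complexBetti A.X 1))) := by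
  haveI : IsSemisimpleRing (bicommutant A) := isSemisimpleRing_bicommutant A
  obtain ⟨h𝔅, h𝔅adj, hψ𝔅, hψc, hZ', r, b, hb, hspan⟩ := bicommutant_typeFour_data hh hnd hψ hRm hRirr hψR hZ
  exact le_adjoin_symmetricPullbackSpan_of_semisimple_of_ne hnd h𝔅 h𝔅adj hψ𝔅 hψc hRm hRirr hψR hadj
    (eigenspace_inf_eigenspace_eq_bot_of_ne_of_exists_zsmul_mem_closure_singleton hRm hRirr hψR hψ'E hne) hZ' hb hspan
    (pullbackOne_mem_bicommutant α) (pullbackOne_mem_bicommutant β) (pullbackOne_mul_ne_of_comp_ne hαβ)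
    (pullbackOne_mem_bicommutant χ)

/-- **TABLE 1, TYPE 4 WITH `d ≥ 2` OR `m ≥ 2`: «`B = End⁰(X)`» (`⊗ ℂ`), FROM `End(X)`** — under the hypotheses of
`pullbackOne_mem_adjoin_symmetricPullbackSpan_of_CMCentre_End_of_ne`, the subalgebra of `End_ℂ H¹(A(ℂ); ℂ)` generated by
`S_λ ⊗ ℂ` is, as a subspace, the `ℂ`-span of the pull-backs (`End⁰(A) ⊗ ℂ` acting, Milne's `E''`).
[cite: MoonenZarhin1998WeilClasses, §1 Table 1 («For all possible types in the Albert classification one can determine the algebra B and its center K_B», chunk p0002 L63–L64) and chunk p0003 L93 («We have F ⊆ B = End⁰(X)»)]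
[cite: Milne1999LefschetzClasses, §1 Remark 1.2 (p. 643)] -/
theorem adjoin_symmetricPullbackSpan_eq_span_of_CMCentre_End_of_ne (hh : h ∈ hodgeClassSpan A.dim A.X 1)
    (hnd : ∀ x : complexBetti A.X 1, (∀ y, polarizationPairingOne A.X h (A.dim - 1) x y = 0) → x = 0)
    (hψ : ∀ χ : A ⟶ A, ψ ≫ χ = χ ≫ ψ) (hRm : R.Monic) (hRirr : Irreducible (R.map (Int.castRingHom ℚ)))
    (hψR : Polynomial.eval₂ (Int.castRingHom (CategoryTheory.End A)) (ψ : CategoryTheory.End A) R = 0)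
    (hadj : ∀ x y : complexBetti A.X 1, polarizationPairingOne A.X h (A.dim - 1) (pullbackOne A ψ x) y =
      polarizationPairingOne A.X h (A.dim - 1) x (pullbackOne A ψ' y))
    (hψ'E : ∃ N : ℤ, N ≠ 0 ∧ End.of (N • ψ') ∈ Subring.closure {End.of ψ}) (hne : ψ' ≠ ψ)
    (hZ : ∀ g : A ⟶ A, (∀ χ : A ⟶ A, g ≫ χ = χ ≫ g) →
      ∃ N : ℤ, N ≠ 0 ∧ End.of (N • g) ∈ Subring.closure {End.of ψ})
    (hαβ : α ≫ β ≠ β ≫ α) :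
    Subalgebra.toSubmodule (Algebra.adjoin ℂ
        (symmetricPullbackSpan A h : Set (Module.End ℂ (complexBetti A.X 1)))) =
      Submodule.span ℂ (Set.range fun χ : A ⟶ A ↦ pullbackOne A χ) := by
  refine le_antisymm (fun T hT ↦ ?_) (Submodule.span_le.2 ?_)
  · exact mem_bicommutant_iff_mem_span.1
      (adjoin_symmetricPullbackSpan_le_bicommutant ((Subalgebra.mem_toSubmodule _).1 hT))
  · rintro _ ⟨χ, rfl⟩
    exact pullbackOne_mem_adjoin_symmetricPullbackSpan_of_CMCentre_End_of_ne hh hnd hψ hRm hRirr hψR hadj hψ'E hne hZ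
      hαβ χ

/-- **«`G_div(X)` is the centralizer of `Δ = D = End⁰(Y)` …», TYPE 4 WITH `d ≥ 2` OR `m ≥ 2`, FROM `End(X)`:
`G_div(X)(h)(ℂ) = S(X)(h)(ℂ)`** — Moonen–Zarhin's group (automorphisms of `H¹(A(ℂ); ℂ)` commuting with `S_λ ⊗ ℂ` and
preserving `Q_h`) is Milne's (commuting with EVERY pull-back), since `B ⊗ ℂ = End⁰(X) ⊗ ℂ`.
[cite: MoonenZarhin1998WeilClasses, §1 (chunk p0002 L67–L71, L92–L97) and chunk p0003 L93] [cite: Milne1999LefschetzClasses, §1 p. 644] -/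
theorem divisorLefschetzGroup_eq_unitaryCentralizerGroup_of_CMCentre_End_of_ne (hh : h ∈ hodgeClassSpan A.dim A.X 1)
    (hnd : ∀ x : complexBetti A.X 1, (∀ y, polarizationPairingOne A.X h (A.dim - 1) x y = 0) → x = 0)
    (hψ : ∀ χ : A ⟶ A, ψ ≫ χ = χ ≫ ψ) (hRm : R.Monic) (hRirr : Irreducible (R.map (Int.castRingHom ℚ)))
    (hψR : Polynomial.eval₂ (Int.castRingHom (CategoryTheory.End A)) (ψ : CategoryTheory.End A) R = 0)
    (hadj : ∀ x y : complexBetti A.X 1, polarizationPairingOne A.X h (A.dim - 1) (pullbackOne A ψ x) y =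
      polarizationPairingOne A.X h (A.dim - 1) x (pullbackOne A ψ' y))
    (hψ'E : ∃ N : ℤ, N ≠ 0 ∧ End.of (N • ψ') ∈ Subring.closure {End.of ψ}) (hne : ψ' ≠ ψ)
    (hZ : ∀ g : A ⟶ A, (∀ χ : A ⟶ A, g ≫ χ = χ ≫ g) →
      ∃ N : ℤ, N ≠ 0 ∧ End.of (N • g) ∈ Subring.closure {End.of ψ})
    (hαβ : α ≫ β ≠ β ≫ α) :
    divisorLefschetzGroup A h = unitaryCentralizerGroup A h :=
  divisorLefschetzGroup_eq_unitaryCentralizerGroup_of_forall_mem_adjoin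
    (pullbackOne_mem_adjoin_symmetricPullbackSpan_of_CMCentre_End_of_ne hh hnd hψ hRm hRirr hψR hadj hψ'E hne hZ hαβ)

/-- **LEMMA (3) «`End(V_X)^{G_div(X)} = B`», TYPE 4 WITH `d ≥ 2` OR `m ≥ 2`, `⊗ ℂ`, FROM `End(X)`**: an endomorphism of
`H¹(A(ℂ); ℂ)` commutes with every element of `G_div(X)(h)(ℂ)` iff it lies in `End⁰(A) ⊗ ℂ`, the `ℂ`-span of the pull-backs
(`= B ⊗ ℂ` here). [cite: MoonenZarhin1998WeilClasses, §1 Lemma (3) (chunk p0003 L5) with Table 1 (chunk p0003 L93)]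
[cite: Deligne1982HodgeCycles, I §3 Prop. 3.4] -/
theorem forall_mem_divisorLefschetzGroup_comm_iff_mem_span_of_CMCentre_End_of_ne (hh : h ∈ hodgeClassSpan A.dim A.X 1)
    (hnd : ∀ x : complexBetti A.X 1, (∀ y, polarizationPairingOne A.X h (A.dim - 1) x y = 0) → x = 0)
    (hψ : ∀ χ : A ⟶ A, ψ ≫ χ = χ ≫ ψ) (hRm : R.Monic) (hRirr : Irreducible (R.map (Int.castRingHom ℚ)))
    (hψR : Polynomial.eval₂ (Int.castRingHom (CategoryTheory.End A)) (ψ : CategoryTheory.End A) R = 0)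
    (hadj : ∀ x y : complexBetti A.X 1, polarizationPairingOne A.X h (A.dim - 1) (pullbackOne A ψ x) y =
      polarizationPairingOne A.X h (A.dim - 1) x (pullbackOne A ψ' y))
    (hψ'E : ∃ N : ℤ, N ≠ 0 ∧ End.of (N • ψ') ∈ Subring.closure {End.of ψ}) (hne : ψ' ≠ ψ)
    (hZ : ∀ g : A ⟶ A, (∀ χ : A ⟶ A, g ≫ χ = χ ≫ g) →
      ∃ N : ℤ, N ≠ 0 ∧ End.of (N • g) ∈ Subring.closure {End.of ψ})
    (hαβ : α ≫ β ≠ β ≫ α) {T : Module.End ℂ (complexBetti A.X 1)} :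
    (∀ u ∈ divisorLefschetzGroup A h, ∀ y : complexBetti A.X 1, T (u y) = u (T y)) ↔
      T ∈ Submodule.span ℂ (Set.range fun χ : A ⟶ A ↦ pullbackOne A χ) := by
  rw [forall_mem_divisorLefschetzGroup_comm_iff_mem_adjoin hh
      (pullbackOne_mem_adjoin_symmetricPullbackSpan_of_CMCentre_End_of_ne hh hnd hψ hRm hRirr hψR hadj hψ'E hne hZ hαβ),
    ← Subalgebra.mem_toSubmodule,
    adjoin_symmetricPullbackSpan_eq_span_of_CMCentre_End_of_ne hh hnd hψ hRm hRirr hψR hadj hψ'E hne hZ hαβ]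

/-- **LEMMA (1) «the center of `G_div(X)` is `U_{K_B}`», `K_B = E`, TYPE 4 WITH `d ≥ 2` OR `m ≥ 2`, `ℂ`-points, FROM
`End(X)`**: an element of `G_div(X)(h)(ℂ)` is CENTRAL iff its underlying endomorphism lies in `ℂ[ψ^*] = E ⊗ ℂ` («`U_E =
Z(G_div)`»).  (`⇒`: a central `z` lies in `End⁰ ⊗ ℂ = E''` by Deligne I 3.4, and commutes with `E''` because `G_div = S(X)`
centralizes every pull-back, so `z ∈ Z(E'') = ℂ[ψ^*]`; `⇐`: `ℂ[ψ^*] ⊆ E'' = B ⊗ ℂ`, which `G_div` centralizes.)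
[cite: MoonenZarhin1998WeilClasses, §1 Lemma (1) (chunk p0002 L121–L127: «For X of type 4 with either d ≥ 2 or m ≥ 2 this is a connected torus of rank e₀») and chunk p0003 L97 («U_E = Z(G_div) ⊂ G_div(X)»)]
[cite: Deligne1982HodgeCycles, I §3 Prop. 3.4] [cite: Milne1999LefschetzClasses, §1 Remark 1.2 (p. 643)] -/
theorem mem_center_divisorLefschetzGroup_iff_coe_mem_adjoin_singleton_of_CMCentre_End_of_ne
    (hh : h ∈ hodgeClassSpan A.dim A.X 1)
    (hnd : ∀ x : complexBetti A.X 1, (∀ y, polarizationPairingOne A.X h (A.dim - 1) x y = 0) → x = 0)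
    (hψ : ∀ χ : A ⟶ A, ψ ≫ χ = χ ≫ ψ) (hRm : R.Monic) (hRirr : Irreducible (R.map (Int.castRingHom ℚ)))
    (hψR : Polynomial.eval₂ (Int.castRingHom (CategoryTheory.End A)) (ψ : CategoryTheory.End A) R = 0)
    (hadj : ∀ x y : complexBetti A.X 1, polarizationPairingOne A.X h (A.dim - 1) (pullbackOne A ψ x) y =
      polarizationPairingOne A.X h (A.dim - 1) x (pullbackOne A ψ' y))
    (hψ'E : ∃ N : ℤ, N ≠ 0 ∧ End.of (N • ψ') ∈ Subring.closure {End.of ψ}) (hne : ψ' ≠ ψ)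
    (hZ : ∀ g : A ⟶ A, (∀ χ : A ⟶ A, g ≫ χ = χ ≫ g) →
      ∃ N : ℤ, N ≠ 0 ∧ End.of (N • g) ∈ Subring.closure {End.of ψ})
    (hαβ : α ≫ β ≠ β ≫ α) {z : divisorLefschetzGroup A h} :
    z ∈ Subgroup.center (divisorLefschetzGroup A h) ↔
      ((z : complexBetti A.X 1 ≃ₗ[ℂ] complexBetti A.X 1) : Module.End ℂ (complexBetti A.X 1)) ∈
        Algebra.adjoin ℂ ({pullbackOne A ψ} : Set (Module.End ℂ (complexBetti A.X 1))) := by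
  have hB := pullbackOne_mem_adjoin_symmetricPullbackSpan_of_CMCentre_End_of_ne hh hnd hψ hRm hRirr hψR hadj hψ'E hne
    hZ hαβ
  obtain ⟨-, -, -, -, hZ', -⟩ := bicommutant_typeFour_data hh hnd hψ hRm hRirr hψR hZ
  rw [mem_center_divisorLefschetzGroup_iff_coe_mem_span hh hB]
  constructor
  · intro hz
    -- `z ∈ E''`, and `z ∈ G_div = S(X)` centralizes every pull-back, hence `z ∈ Z(E'') = ℂ[ψ^*]`
    have hzE : ((z : complexBetti A.X 1 ≃ₗ[ℂ] complexBetti A.X 1) : Module.End ℂ (complexBetti A.X 1)) ∈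
        bicommutant A := mem_bicommutant_iff_mem_span.2 hz
    have hzS : (z : complexBetti A.X 1 ≃ₗ[ℂ] complexBetti A.X 1) ∈ unitaryCentralizerGroup A h := by
      rw [← divisorLefschetzGroup_eq_unitaryCentralizerGroup_of_CMCentre_End_of_ne hh hnd hψ hRm hRirr hψR hadj hψ'E
        hne hZ hαβ]
      exact z.2
    have hzC : ((z : complexBetti A.X 1 ≃ₗ[ℂ] complexBetti A.X 1) : Module.End ℂ (complexBetti A.X 1)) ∈
        centralizerAlgebra A := by
      refine mem_centralizerAlgebra_iff.2 fun φ ↦ LinearMap.ext fun x ↦ ?_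
      rw [Module.End.mul_apply, Module.End.mul_apply, LinearEquiv.coe_coe, (mem_centralizerGroup_iff.1 hzS.1) φ x]
    exact hZ' _ hzE fun X hX ↦ ((Subalgebra.mem_centralizer_iff ℂ).1 hX _ hzC).symm
  · intro hz
    have hle : Algebra.adjoin ℂ ({pullbackOne A ψ} : Set (Module.End ℂ (complexBetti A.X 1))) ≤ bicommutant A :=
      Algebra.adjoin_le (Set.singleton_subset_iff.2 (pullbackOne_mem_bicommutant ψ))
    exact mem_bicommutant_iff_mem_span.1 (hle hz)

/-- **LEMMA (1) as the print's set «`U_E(ℂ) = {a ∈ (E ⊗ ℂ)^* ∣ a a† = 1}`», TYPE 4 WITH `d ≥ 2` OR `m ≥ 2`, FROM `End(X)`**: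
an automorphism `U` of `H¹(A(ℂ); ℂ)` is a central element of `G_div(X)(h)(ℂ)` iff `U ∈ ℂ[ψ^*]` and `U` preserves `Q_h`
(the condition «`a a† = 1`», cf. `forall_polarizationPairingOne_map_map_eq_iff_mul_adjoint_eq_one`).
[cite: MoonenZarhin1998WeilClasses, §1 Lemma (1) (chunk p0002 L121–L127) and chunk p0003 L97 («U_E = Z(G_div)»)]
[cite: Deligne1982HodgeCycles, I §3 Prop. 3.4] -/
theorem mem_divisorLefschetzGroup_and_forall_comm_iff_of_CMCentre_End_of_ne (hh : h ∈ hodgeClassSpan A.dim A.X 1)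
    (hnd : ∀ x : complexBetti A.X 1, (∀ y, polarizationPairingOne A.X h (A.dim - 1) x y = 0) → x = 0)
    (hψ : ∀ χ : A ⟶ A, ψ ≫ χ = χ ≫ ψ) (hRm : R.Monic) (hRirr : Irreducible (R.map (Int.castRingHom ℚ)))
    (hψR : Polynomial.eval₂ (Int.castRingHom (CategoryTheory.End A)) (ψ : CategoryTheory.End A) R = 0)
    (hadj : ∀ x y : complexBetti A.X 1, polarizationPairingOne A.X h (A.dim - 1) (pullbackOne A ψ x) y =
      polarizationPairingOne A.X h (A.dim - 1) x (pullbackOne A ψ' y))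
    (hψ'E : ∃ N : ℤ, N ≠ 0 ∧ End.of (N • ψ') ∈ Subring.closure {End.of ψ}) (hne : ψ' ≠ ψ)
    (hZ : ∀ g : A ⟶ A, (∀ χ : A ⟶ A, g ≫ χ = χ ≫ g) →
      ∃ N : ℤ, N ≠ 0 ∧ End.of (N • g) ∈ Subring.closure {End.of ψ})
    (hαβ : α ≫ β ≠ β ≫ α) {U : complexBetti A.X 1 ≃ₗ[ℂ] complexBetti A.X 1} :
    (U ∈ divisorLefschetzGroup A h ∧ ∀ g ∈ divisorLefschetzGroup A h, g * U = U * g) ↔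
      (U : Module.End ℂ (complexBetti A.X 1)) ∈
          Algebra.adjoin ℂ ({pullbackOne A ψ} : Set (Module.End ℂ (complexBetti A.X 1))) ∧
        ∀ x y : complexBetti A.X 1, polarizationPairingOne A.X h (A.dim - 1) (U x) (U y) =
          polarizationPairingOne A.X h (A.dim - 1) x y := by
  have hB := pullbackOne_mem_adjoin_symmetricPullbackSpan_of_CMCentre_End_of_ne hh hnd hψ hRm hRirr hψR hadj hψ'E hne
    hZ hαβ
  constructor
  · rintro ⟨hU, hc⟩
    refine ⟨?_, hU.2⟩
    have hz : (⟨U, hU⟩ : divisorLefschetzGroup A h) ∈ Subgroup.center (divisorLefschetzGroup A h) := by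
      rw [Subgroup.mem_center_iff]
      intro g
      exact Subtype.ext (hc g g.2)
    exact (mem_center_divisorLefschetzGroup_iff_coe_mem_adjoin_singleton_of_CMCentre_End_of_ne hh hnd hψ hRm hRirr hψR
      hadj hψ'E hne hZ hαβ).1 hz
  · rintro ⟨hUψ, hUQ⟩
    obtain ⟨-, -, -, hψc, -, -⟩ := bicommutant_typeFour_data hh hnd hψ hRm hRirr hψR hZ
    refine (mem_divisorLefschetzGroup_and_forall_comm_iff hh hB).2 ⟨?_, fun T hT ↦ ?_, hUQ⟩
    · -- `ℂ[ψ^*] ⊆ B ⊗ ℂ`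
      have hle : Algebra.adjoin ℂ ({pullbackOne A ψ} : Set (Module.End ℂ (complexBetti A.X 1))) ≤
          Algebra.adjoin ℂ (symmetricPullbackSpan A h : Set (Module.End ℂ (complexBetti A.X 1))) :=
        Algebra.adjoin_le (Set.singleton_subset_iff.2 (hB ψ))
      exact hle hUψ
    · -- `T ∈ B ⊗ ℂ ⊆ E''` commutes with `ψ^*`, hence with `ℂ[ψ^*] ∋ U`
      have hcomm : Commute T (pullbackOne A ψ) := hψc T (adjoin_symmetricPullbackSpan_le_bicommutant hT)
      exact (Algebra.commute_of_mem_adjoin_singleton_of_commute hUψ hcomm).eq.symm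

end EndLevel

end Literature.AlgebraicGeometry.HodgeTheory

end
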